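import Summits.AtomisticToContinuum.FouriersLaw.Theorems.VanishingNoiseTransferNoiseLocalityStubResponseDensityNoisyDyson2
import Summits.AtomisticToContinuum.FouriersLaw.Theorems.PhononMeanFreePathBoundaryKuboJointFeller

/-!
# Flip-noisy response density, step 3: joint continuity in (bath temperatures, initial condition)
of weighted observables under the kernels (helpers for stub `stub_responseDensityNoisy`)

Helper file `--supports stmt-AtomisticToContinuum-11975` (crux `NoiseLocality`, route
`VanishingNoiseTransfer`, line `relative-flip-energy-transfer`, stub 1b `stub_responseDensityNoisy`),
namespace `…NoiseLocality.StubResponseDensityNoisy.Dyson`.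

**Weighted joint Feller properties** of the pinned chain (all parameters `> 0`, `N ≥ 1`, `T > 0`,
weight `e^{ϑH}` with `0 < ϑ`, `2ϑ < 1/(2T)`): if `(y, x) ↦ F_y(x)` is jointly continuous on
`Y × (phase space)` with `|F_y| ≤ C e^{ϑH}` and the bath temperatures `τ_L(y), τ_R(y) ∈ (0, 2T]`
depend continuously on `y`, then `(y, x) ↦ P^{τ(y)}_t F_y(x)` (`continuous_integral_kernel_param`),
`(y, x) ↦ R^{τ(y)}_r F_y(x)` (`continuous_integral_resolventKernel_param`) and
`(y, x) ↦ (K^{τ(y)})ⁿ F_y(x)` for the embedded flip chain `K = Q ∘ₖ R_r`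
(`continuous_integral_embeddedFlipKernel_pow_param`) are jointly continuous. Ingredients: the
pathwise joint continuity of the solution map (`pinnedChain_continuous_solMap_temp_prod`), bounded
convergence on energy cut-offs, a uniform tail bound from the orbit bound at the exponent `2ϑ`
(`…Dyson1`), and the average over the exponential time.

No definitions.
-/

noncomputable section

open MeasureTheory ProbabilityTheory Filter Topology Set
open scoped NNReal ENNReal

namespace Summit.AtomisticToContinuum.FouriersLaw.Theorems.NoiseLocality.StubResponseDensityNoisy.Dyson

open Literature.MathematicalPhysics.KineticTheory.HeatConduction
open Literature.Probability.Process Literature.MathematicalPhysics.KineticTheory OscillatorChain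
open Summit.AtomisticToContinuum.FouriersLaw.Theorems.BoundaryKubo.GibbsTtcf


/-! ### Joint continuity in (temperatures, initial condition) of weighted observables -/

section JointFeller

variable {N : ℕ} {ω₂ lam β γ : ℝ} (hω : 0 < ω₂) (hl : 0 < lam) (hβ : 0 < β) (hγ : 0 < γ) (hN : 0 < N)
  {T : ℝ} (hT : 0 < T) {ϑ : ℝ} (hϑ : 0 < ϑ) (h2ϑT : 2 * ϑ < 1 / (2 * T))
include hω hl hβ hγ hN hT hϑ h2ϑT

omit hω hl hβ hγ hN hT in
/-- `ϑ < 1/(2T)` as well. -/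
theorem theta_lt_of_two_theta_lt : ϑ < 1 / (2 * T) := by linarith

omit hω hl hβ hγ hN hT h2ϑT in
/-- The pointwise tail bound behind the energy cut-off: if `|F| ≤ C e^{ϑH}` then
`|F(z) - χ(H(z)/K) F(z)| ≤ C e^{-ϑK} e^{2ϑH(z)}` (`χ = smoothCutoff`, `K > 0`). -/
theorem abs_sub_cutoff_mul_le {F : PhaseSpace N → ℝ} {C : ℝ} (hC : 0 ≤ C)
    (hFb : ∀ z, |F z| ≤ C * Real.exp (ϑ * (pinnedChain ω₂ lam β γ).hamiltonian N z)) {K : ℝ}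
    (hK : 0 < K) (z : PhaseSpace N) :
    |F z - smoothCutoff ((pinnedChain ω₂ lam β γ).hamiltonian N z / K) * F z| ≤
      C * Real.exp (-ϑ * K) * Real.exp (2 * ϑ * (pinnedChain ω₂ lam β γ).hamiltonian N z) := by
  -- adapted from `pinnedChain_tendsto_integral_kernel_temps` (…ResponseDensityKernelContinuity)
  set Hz := (pinnedChain ω₂ lam β γ).hamiltonian N z
  rcases le_or_gt Hz K with hle | hlt
  · rw [smoothCutoff_of_le_one ((div_le_one hK).2 hle), one_mul, sub_self, abs_zero]
    positivity
  · have h1 : |F z - smoothCutoff (Hz / K) * F z| ≤ |F z| := by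
      rw [show F z - smoothCutoff (Hz / K) * F z = (1 - smoothCutoff (Hz / K)) * F z by ring,
        abs_mul, abs_of_nonneg (by linarith [smoothCutoff_le_one (Hz / K)])]
      exact mul_le_of_le_one_left (abs_nonneg _) (by linarith [smoothCutoff_nonneg (Hz / K)])
    have h2 : Real.exp (ϑ * Hz) ≤ Real.exp (-ϑ * K) * Real.exp (2 * ϑ * Hz) := by
      rw [← Real.exp_add]; exact Real.exp_le_exp.2 (by nlinarith)
    calc _ ≤ |F z| := h1
      _ ≤ C * Real.exp (ϑ * Hz) := hFb z
      _ ≤ C * (Real.exp (-ϑ * K) * Real.exp (2 * ϑ * Hz)) := mul_le_mul_of_nonneg_left h2 hC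
      _ = _ := by ring

/-- **Weighted joint Feller property of the transition kernels.** If `(y, x) ↦ F_y(x)` is jointly
continuous with `|F_y| ≤ C e^{ϑH}` and the temperatures `τ_L(y), τ_R(y) ∈ (0, 2T]` are continuous in
`y`, then `(y, x) ↦ P^{τ_L(y), τ_R(y)}_t F_y (x)` is jointly continuous. -/
theorem continuous_integral_kernel_param {Y : Type*} [TopologicalSpace Y] [FirstCountableTopology Y]
    {τL τR : Y → ℝ}
    (hτL : Continuous τL) (hτR : Continuous τR)
    (hwin : ∀ y, 0 < τL y ∧ τL y ≤ 2 * T ∧ 0 < τR y ∧ τR y ≤ 2 * T)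
    {F : Y → PhaseSpace N → ℝ} (hF : Continuous fun p : Y × PhaseSpace N => F p.1 p.2)
    {C : ℝ} (hC : 0 ≤ C)
    (hFb : ∀ y x, |F y x| ≤ C * Real.exp (ϑ * (pinnedChain ω₂ lam β γ).hamiltonian N x)) (t : ℝ≥0) :
    Continuous fun p : Y × PhaseSpace N =>
      ∫ z, F p.1 z ∂((pinnedChain ω₂ lam β γ).transitionKernel N (τL p.1) (τR p.1) t p.2) := by
  set Pc := pinnedChain ω₂ lam β γ with hPc
  set Hm := Pc.hamiltonian N with hHm
  have hHc : Continuous Hm := pinnedChain_continuous_hamiltonian ω₂ lam β γ N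
  have hsc : Continuous smoothCutoff := (contDiff_smoothCutoff (n := 0)).continuous
  -- the orbit bound at the exponent `2ϑ`
  obtain ⟨c₂, B₂, _a, _b, hc₂, hB₂, _ha, _hb, hunif⟩ := lintegral_exp_kernel_resolventKernel_le_unif hω hl
    hβ hγ hN hT (ϑ := 2 * ϑ) (by positivity) h2ϑT one_pos
  -- continuity of each `F y`, and joint continuity of the truncated integrands
  have hFy : ∀ y, Continuous (F y) := fun y => hF.comp (Continuous.prodMk_right y)
  -- integrals of `F y` and of truncations, through the solution map
  refine continuous_of_locally_uniform_approx_of_continuousAt fun p₀ u hu => ?_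
  obtain ⟨ε, hε, hεu⟩ := Metric.mem_uniformity_dist.1 hu
  -- the neighbourhood `{H(x) < H(x₀) + 1}`
  set E₀ : ℝ := Hm p₀.2 + 1 with hE₀
  set tset : Set (Y × PhaseSpace N) := {p | Hm p.2 < E₀} with htset
  have ht : tset ∈ 𝓝 p₀ :=
    (isOpen_lt (hHc.comp continuous_snd) continuous_const).mem_nhds (by simp [hE₀])
  -- the tail constant `W K = C e^{-ϑK} (c₂ e^{2ϑE₀} + B₂)` and the choice of `K`
  set A : ℝ≥0∞ := c₂ * ENNReal.ofReal (Real.exp (2 * ϑ * E₀)) + B₂ with hA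
  have hAtop : A ≠ ⊤ := ENNReal.add_ne_top.2 ⟨ENNReal.mul_ne_top hc₂ ENNReal.ofReal_ne_top, hB₂⟩
  obtain ⟨K, hK0, hK⟩ : ∃ K : ℝ, 0 < K ∧ C * Real.exp (-ϑ * K) * A.toReal < ε := by
    have h1 : Tendsto (fun K : ℝ => -ϑ * K) atTop atBot :=
      tendsto_id.const_mul_atTop_of_neg (by linarith : -ϑ < 0)
    have h2 : Tendsto (fun K : ℝ => C * Real.exp (-ϑ * K) * A.toReal) atTop (𝓝 (C * 0 * A.toReal)) :=
      ((Real.tendsto_exp_atBot.comp h1).const_mul C).mul_const _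
    rw [mul_zero, zero_mul] at h2
    obtain ⟨K, hK⟩ := ((h2.eventually (Iio_mem_nhds hε)).and (eventually_gt_atTop 0)).exists
    exact ⟨K, hK.2, hK.1⟩
  -- the truncated observable and its forecast
  set G : Y → PhaseSpace N → ℝ := fun y z => smoothCutoff (Hm z / K) * F y z with hG
  have hGc : Continuous fun p : Y × PhaseSpace N => G p.1 p.2 :=
    ((hsc.comp ((hHc.comp continuous_snd).div_const K))).mul hF
  have hGb : ∀ y z, |G y z| ≤ C * Real.exp (ϑ * (2 * K)) := by
    intro y z
    rw [hG]; dsimp only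
    rcases le_or_gt (Hm z) (2 * K) with hz | hz
    · rw [abs_mul, abs_of_nonneg (smoothCutoff_nonneg _)]
      calc smoothCutoff (Hm z / K) * |F y z| ≤ 1 * |F y z| :=
            mul_le_mul_of_nonneg_right (smoothCutoff_le_one _) (abs_nonneg _)
        _ ≤ C * Real.exp (ϑ * Hm z) := by rw [one_mul]; exact hFb y z
        _ ≤ C * Real.exp (ϑ * (2 * K)) := by gcongr
    · rw [smoothCutoff_of_two_le ((le_div_iff₀ hK0).2 (by linarith)), zero_mul, abs_zero]
      positivity
  refine ⟨tset, ht, fun p => ∫ z, G p.1 z ∂(Pc.transitionKernel N (τL p.1) (τR p.1) t p.2), ?_,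
    fun p hp => hεu ?_⟩
  · -- continuity of the truncated forecast (bounded convergence along the paths)
    refine Continuous.continuousAt ?_
    have heq : (fun p : Y × PhaseSpace N => ∫ z, G p.1 z ∂(Pc.transitionKernel N (τL p.1) (τR p.1) t p.2)) =
        fun p => ∫ w, G p.1 (Pc.solMap N (τL p.1) (τR p.1) t p.2 (pairPath w)) ∂wienerPair := by
      funext p
      exact pinnedChain_integral_transitionKernel hω hl.le hβ.le hγ.le N _ _ t p.2
        ((hGc.comp (Continuous.prodMk_right p.1)).aestronglyMeasurable)
    rw [heq]
    refine continuous_of_dominated (bound := fun _ => C * Real.exp (ϑ * (2 * K))) (fun p => ?_)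
      (fun p => Eventually.of_forall fun w => ?_) (integrable_const _) (Eventually.of_forall fun w => ?_)
    · exact ((hGc.comp (Continuous.prodMk_right p.1)).measurable.comp
        (pinnedChain_measurable_solMap_pairPath_right hω hl.le hβ.le hγ.le N _ _ t p.2)).aestronglyMeasurable
    · rw [Real.norm_eq_abs]; exact hGb _ _
    · have h1 := pinnedChain_continuous_solMap_temp_prod hω hl.le hβ.le hγ.le N t.coe_nonneg (pairPath w)
      have h2 : Continuous fun p : Y × PhaseSpace N => (τL p.1, τR p.1, p.2) := by fun_prop
      -- NB: build the composite first (elaborating against the expected type unfolds the flow)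
      have h12 := h1.comp h2
      have h3 : Continuous fun p : Y × PhaseSpace N =>
          (p.1, Pc.solMap N (τL p.1) (τR p.1) t p.2 (pairPath w)) :=
        continuous_fst.prodMk (by simpa only [Function.comp_def] using h12)
      have h4 := hGc.comp h3
      exact h4
  · -- the tail: `|P F - P G| ≤ C e^{-ϑK} (c₂ e^{2ϑH(x)} + B₂) ≤ W K < ε` on `tset`
    obtain ⟨hL, hL', hR, hR'⟩ := hwin p.1
    have hWm : Measurable fun z => Real.exp (2 * ϑ * Hm z) :=
      (Real.continuous_exp.comp (continuous_const.mul hHc)).measurable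
    have hbound := (hunif (τL p.1) (τR p.1) hL hL' hR hR').1 t p.2
    have hAp : c₂ * ENNReal.ofReal (Real.exp (2 * ϑ * Hm p.2)) + B₂ ≤ A := by
      have hexp : Real.exp (2 * ϑ * Hm p.2) ≤ Real.exp (2 * ϑ * E₀) :=
        Real.exp_le_exp.2 (mul_le_mul_of_nonneg_left (le_of_lt hp) (by positivity))
      exact add_le_add (mul_le_mul' le_rfl (ENNReal.ofReal_le_ofReal hexp)) le_rfl
    have hGy := hGc.comp (Continuous.prodMk_right p.1)
    have hdiff := integrable_abs_integral_le_of_lintegral_le (μ := Pc.transitionKernel N (τL p.1) (τR p.1) t p.2)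
      hWm (fun z => (Real.exp_pos _).le) hAtop (hbound.trans hAp) (g := fun z => F p.1 z - G p.1 z)
      (((hFy p.1).sub hGy).aestronglyMeasurable) (by positivity : 0 ≤ C * Real.exp (-ϑ * K))
      (fun z => abs_sub_cutoff_mul_le hϑ hC (hFb p.1) hK0 z)
    have hFi := (integrable_abs_integral_le_of_lintegral_le (μ := Pc.transitionKernel N (τL p.1) (τR p.1) t p.2)
      hWm (fun z => (Real.exp_pos _).le) hAtop (hbound.trans hAp) (hFy p.1).aestronglyMeasurable hC
      (fun z => (hFb p.1 z).trans (mul_le_mul_of_nonneg_left (Real.exp_le_exp.2 (by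
        nlinarith [pinnedChain_hamiltonian_nonneg hω.le hl.le hβ.le γ N z])) hC))).1
    have hGi : Integrable (fun z => G p.1 z) (Pc.transitionKernel N (τL p.1) (τR p.1) t p.2) := by
      have := hFi.sub hdiff.1
      refine this.congr (Eventually.of_forall fun z => ?_)
      simp only [Pi.sub_apply, sub_sub_cancel]
    have hsub : (∫ z, F p.1 z ∂(Pc.transitionKernel N (τL p.1) (τR p.1) t p.2)) -
        ∫ z, G p.1 z ∂(Pc.transitionKernel N (τL p.1) (τR p.1) t p.2) =
        ∫ z, (F p.1 z - G p.1 z) ∂(Pc.transitionKernel N (τL p.1) (τR p.1) t p.2) :=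
      (integral_sub hFi hGi).symm
    rw [Real.dist_eq]
    dsimp only
    rw [hsub]
    exact hdiff.2.trans_lt hK

/-- **Weighted joint Feller property of the resolvent kernels**: under the hypotheses of
`continuous_integral_kernel_param`, `(y, x) ↦ R^{τ_L(y), τ_R(y)}_r F_y (x)` is jointly continuous, and
`F_y ∈ L¹(R^{τ(y)}_r(x, ·))` (average over the exponential time; dominated convergence with the
uniform orbit bound of `…Dyson1`). -/
theorem continuous_integral_resolventKernel_param {Y : Type*} [TopologicalSpace Y]
    [FirstCountableTopology Y] {τL τR : Y → ℝ} (hτL : Continuous τL) (hτR : Continuous τR)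
    (hwin : ∀ y, 0 < τL y ∧ τL y ≤ 2 * T ∧ 0 < τR y ∧ τR y ≤ 2 * T)
    {F : Y → PhaseSpace N → ℝ} (hF : Continuous fun p : Y × PhaseSpace N => F p.1 p.2)
    {C : ℝ} (hC : 0 ≤ C)
    (hFb : ∀ y x, |F y x| ≤ C * Real.exp (ϑ * (pinnedChain ω₂ lam β γ).hamiltonian N x))
    {r : ℝ} (hr : 0 < r) :
    (∀ (y : Y) (x : PhaseSpace N), Integrable (F y) ((pinnedChainSemigroup hω hl.le hβ.le hγ.le hN
        (hwin y).1.le (hwin y).2.2.1.le).resolventKernel r x)) ∧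
    Continuous fun p : Y × PhaseSpace N => ∫ z, F p.1 z ∂((pinnedChainSemigroup hω hl.le hβ.le hγ.le hN
        (hwin p.1).1.le (hwin p.1).2.2.1.le).resolventKernel r p.2) := by
  set Pc := pinnedChain ω₂ lam β γ with hPc
  set Hm := Pc.hamiltonian N with hHm
  have hHc : Continuous Hm := pinnedChain_continuous_hamiltonian ω₂ lam β γ N
  haveI := isProbabilityMeasure_expMeasure hr
  have hϑT : ϑ < 1 / (2 * T) := theta_lt_of_two_theta_lt hϑ h2ϑT
  obtain ⟨c, B, a, b, hc, hB, _ha, hb, hunif⟩ :=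
    lintegral_exp_kernel_resolventKernel_le_unif hω hl hβ hγ hN hT hϑ hϑT hr
  have hFy : ∀ y, Continuous (F y) := fun y => hF.comp (Continuous.prodMk_right y)
  have hWm : Measurable fun z => Real.exp (ϑ * Hm z) :=
    (Real.continuous_exp.comp (continuous_const.mul hHc)).measurable
  -- integrability against the resolvent kernel and against the transition kernels, with bounds
  have hIR : ∀ (y : Y) (x : PhaseSpace N), Integrable (F y) ((pinnedChainSemigroup hω hl.le hβ.le hγ.le hN
      (hwin y).1.le (hwin y).2.2.1.le).resolventKernel r x) := fun y x =>
    (integrable_abs_integral_le_of_lintegral_le hWm (fun z => (Real.exp_pos _).le)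
      (ENNReal.add_ne_top.2 ⟨ENNReal.mul_ne_top _ha.ne_top ENNReal.ofReal_ne_top, hb⟩)
      ((hunif _ _ (hwin y).1 (hwin y).2.1 (hwin y).2.2.1 (hwin y).2.2.2).2 x) (hFy y).aestronglyMeasurable
      hC (hFb y)).1
  have hIP : ∀ (y : Y) (t : ℝ≥0) (x : PhaseSpace N),
      Integrable (F y) (Pc.transitionKernel N (τL y) (τR y) t x) ∧
      |∫ z, F y z ∂(Pc.transitionKernel N (τL y) (τR y) t x)| ≤
        C * (c * ENNReal.ofReal (Real.exp (ϑ * Hm x)) + B).toReal := fun y t x =>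
    integrable_abs_integral_le_of_lintegral_le hWm (fun z => (Real.exp_pos _).le)
      (ENNReal.add_ne_top.2 ⟨ENNReal.mul_ne_top hc ENNReal.ofReal_ne_top, hB⟩)
      ((hunif _ _ (hwin y).1 (hwin y).2.1 (hwin y).2.2.1 (hwin y).2.2.2).1 t x) (hFy y).aestronglyMeasurable
      hC (hFb y)
  refine ⟨hIR, ?_⟩
  -- through the exponential time
  have heq : (fun p : Y × PhaseSpace N => ∫ z, F p.1 z ∂((pinnedChainSemigroup hω hl.le hβ.le hγ.le hN
      (hwin p.1).1.le (hwin p.1).2.2.1.le).resolventKernel r p.2)) = fun p =>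
      ∫ t, (∫ z, F p.1 z ∂(Pc.transitionKernel N (τL p.1) (τR p.1) t.toNNReal p.2)) ∂(expMeasure r) := by
    funext p
    exact integral_resolventKernel_of_integrable _ hr p.2 (hFy p.1).stronglyMeasurable (hIR p.1 p.2)
  rw [heq]
  refine continuous_iff_continuousAt.2 fun p₀ => ?_
  set E₀ : ℝ := Hm p₀.2 + 1 with hE₀
  have ht : {p : Y × PhaseSpace N | Hm p.2 < E₀} ∈ 𝓝 p₀ :=
    (isOpen_lt (hHc.comp continuous_snd) continuous_const).mem_nhds (by simp [hE₀])
  refine continuousAt_of_dominated (bound := fun _ => C * (c * ENNReal.ofReal (Real.exp (ϑ * E₀)) + B).toReal)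
    (Eventually.of_forall fun p => ?_) ?_ (integrable_const _) (Eventually.of_forall fun t => ?_)
  · have h1 := ((hFy p.1).stronglyMeasurable.integral_kernel
      (κ := (pinnedChainSemigroup hω hl.le hβ.le hγ.le hN (hwin p.1).1.le (hwin p.1).2.2.1.le).timeKernel)).measurable
    have h2 : Measurable fun t : ℝ => (t, p.2) := measurable_id.prodMk measurable_const
    exact (h1.comp h2).aestronglyMeasurable
  · filter_upwards [ht] with p hp
    refine Eventually.of_forall fun t => ?_
    rw [Real.norm_eq_abs]
    refine (hIP p.1 t.toNNReal p.2).2.trans (mul_le_mul_of_nonneg_left ?_ hC)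
    have hfin : c * ENNReal.ofReal (Real.exp (ϑ * E₀)) + B ≠ ⊤ :=
      ENNReal.add_ne_top.2 ⟨ENNReal.mul_ne_top hc ENNReal.ofReal_ne_top, hB⟩
    have hexp : Real.exp (ϑ * Hm p.2) ≤ Real.exp (ϑ * E₀) :=
      Real.exp_le_exp.2 (mul_le_mul_of_nonneg_left (le_of_lt hp) hϑ.le)
    exact ENNReal.toReal_mono hfin (add_le_add (mul_le_mul' le_rfl (ENNReal.ofReal_le_ofReal hexp)) le_rfl)
  · exact (continuous_integral_kernel_param hω hl hβ hγ hN hT hϑ h2ϑT hτL hτR hwin hF hC hFb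
      t.toNNReal).continuousAt

omit hω hl hβ hγ hT hϑ h2ϑT in
/-- Averaging over the flips preserves joint continuity and the weighted bound:
`(y, z) ↦ N⁻¹ ∑_i F_y(z^i)` is jointly continuous with `|·| ≤ C e^{ϑH}` (`H(z^i) = H(z)`). -/
theorem flipAverage_continuous_bound {Y : Type*} [TopologicalSpace Y]
    {F : Y → PhaseSpace N → ℝ} (hF : Continuous fun p : Y × PhaseSpace N => F p.1 p.2)
    {C : ℝ} (hFb : ∀ y x, |F y x| ≤ C * Real.exp (ϑ * (pinnedChain ω₂ lam β γ).hamiltonian N x)) :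
    (Continuous fun p : Y × PhaseSpace N => (N : ℝ)⁻¹ * ∑ i : Fin N, F p.1 (momentumFlip i p.2)) ∧
    ∀ y x, |(N : ℝ)⁻¹ * ∑ i : Fin N, F y (momentumFlip i x)| ≤
      C * Real.exp (ϑ * (pinnedChain ω₂ lam β γ).hamiltonian N x) := by
  have hNR : (0 : ℝ) < N := by exact_mod_cast hN
  refine ⟨continuous_const.mul (continuous_finsetSum _ fun i _ =>
    hF.comp (continuous_fst.prodMk ((continuous_momentumFlip i).comp continuous_snd))), fun y x => ?_⟩
  rw [abs_mul, abs_of_pos (inv_pos.2 hNR)]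
  calc (N : ℝ)⁻¹ * |∑ i : Fin N, F y (momentumFlip i x)|
      ≤ (N : ℝ)⁻¹ * ∑ i : Fin N, |F y (momentumFlip i x)| :=
        mul_le_mul_of_nonneg_left (Finset.abs_sum_le_sum_abs _ _) (inv_pos.2 hNR).le
    _ ≤ (N : ℝ)⁻¹ * ∑ _i : Fin N, C * Real.exp (ϑ * (pinnedChain ω₂ lam β γ).hamiltonian N x) := by
        gcongr with i
        have h := hFb y (momentumFlip i x)
        rwa [OscillatorChain.hamiltonian_momentumFlip] at h
    _ = C * Real.exp (ϑ * (pinnedChain ω₂ lam β γ).hamiltonian N x) := by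
        rw [Finset.sum_const, Finset.card_univ, Fintype.card_fin, nsmul_eq_mul, ← mul_assoc,
          inv_mul_cancel₀ hNR.ne', one_mul]

/-- **Weighted joint Feller property of the embedded flip chain and of its powers**: under the
hypotheses of `continuous_integral_kernel_param`, for every `n`,
`(y, x) ↦ (K^{τ(y)})ⁿ F_y (x)` is jointly continuous, `F_y ∈ L¹((K^{τ(y)})ⁿ(x, ·))`, and
`|(K^{τ(y)})ⁿ F_y (x)| ≤ C (e^{ϑH(x)} + C_p)` (`K F = R (Q F)`, induction on `n`). -/
theorem continuous_integral_embeddedFlipKernel_pow_param {Y : Type*} [TopologicalSpace Y]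
    [FirstCountableTopology Y] {τL τR : Y → ℝ} (hτL : Continuous τL) (hτR : Continuous τR)
    (hwin : ∀ y, 0 < τL y ∧ τL y ≤ 2 * T ∧ 0 < τR y ∧ τR y ≤ 2 * T) {r : ℝ} (hr : 0 < r) :
    ∃ Cp : ℝ, 0 ≤ Cp ∧ ∀ {F : Y → PhaseSpace N → ℝ}, (Continuous fun p : Y × PhaseSpace N => F p.1 p.2) →
      ∀ {C : ℝ}, 0 ≤ C →
      (∀ y x, |F y x| ≤ C * Real.exp (ϑ * (pinnedChain ω₂ lam β γ).hamiltonian N x)) → ∀ n : ℕ,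
      (∀ (y : Y) (x : PhaseSpace N), Integrable (F y) ((((pinnedChainSemigroup hω hl.le hβ.le hγ.le hN
          (hwin y).1.le (hwin y).2.2.1.le).embeddedFlipKernel r) ^ n) x) ∧
        |∫ z, F y z ∂((((pinnedChainSemigroup hω hl.le hβ.le hγ.le hN (hwin y).1.le
          (hwin y).2.2.1.le).embeddedFlipKernel r) ^ n) x)| ≤
          C * (Real.exp (ϑ * (pinnedChain ω₂ lam β γ).hamiltonian N x) + Cp)) ∧
      Continuous fun p : Y × PhaseSpace N => ∫ z, F p.1 z ∂((((pinnedChainSemigroup hω hl.le hβ.le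
          hγ.le hN (hwin p.1).1.le (hwin p.1).2.2.1.le).embeddedFlipKernel r) ^ n) p.2) := by
  set Pc := pinnedChain ω₂ lam β γ with hPc
  set Hm := Pc.hamiltonian N with hHm
  have hHc : Continuous Hm := pinnedChain_continuous_hamiltonian ω₂ lam β γ N
  have hWm : Measurable fun z => Real.exp (ϑ * Hm z) :=
    (Real.continuous_exp.comp (continuous_const.mul hHc)).measurable
  obtain ⟨Cp, hCp, hpow⟩ := lintegral_exp_embeddedFlipKernel_pow_le_unif hω hl hβ hγ hN hT hϑ
    (theta_lt_of_two_theta_lt hϑ h2ϑT) hr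
  refine ⟨Cp.toReal, ENNReal.toReal_nonneg, fun {F} hF {C} hC hFb => ?_⟩
  -- the kernels as (non-dependent) functions of the parameter
  set Kf : Y → Kernel (PhaseSpace N) (PhaseSpace N) := fun y => (pinnedChainSemigroup hω hl.le hβ.le hγ.le hN
    (hwin y).1.le (hwin y).2.2.1.le).embeddedFlipKernel r with hKf
  set Rf : Y → Kernel (PhaseSpace N) (PhaseSpace N) := fun y => (pinnedChainSemigroup hω hl.le hβ.le hγ.le hN
    (hwin y).1.le (hwin y).2.2.1.le).resolventKernel r with hRf
  haveI hMK : ∀ y, IsMarkovKernel (Kf y) := fun y =>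
    (pinnedChainSemigroup hω hl.le hβ.le hγ.le hN (hwin y).1.le (hwin y).2.2.1.le).isMarkovKernel_embeddedFlipKernel hr
  haveI : ∀ (y : Y) (n : ℕ), IsMarkovKernel ((Kf y) ^ n) := fun y n => Harris.isMarkovKernel_pow _ n
  have hFy : ∀ y, Continuous (F y) := fun y => hF.comp (Continuous.prodMk_right y)
  -- integrability and the bound, for every weighted `G` (continuous in `x`) and every `n`
  have hIB : ∀ {G : Y → PhaseSpace N → ℝ}, (∀ y, Continuous (G y)) → ∀ {C' : ℝ}, 0 ≤ C' →
      (∀ y x, |G y x| ≤ C' * Real.exp (ϑ * Hm x)) → ∀ (n : ℕ) (y : Y) (x : PhaseSpace N),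
      Integrable (G y) (((Kf y) ^ n) x) ∧
        |∫ z, G y z ∂(((Kf y) ^ n) x)| ≤ C' * (Real.exp (ϑ * Hm x) + Cp.toReal) := by
    intro G hG C' hC' hGb n y x
    have h := integrable_abs_integral_le_of_lintegral_le hWm (fun z => (Real.exp_pos _).le)
      (ENNReal.add_ne_top.2 ⟨ENNReal.ofReal_ne_top, hCp⟩)
      (hpow _ _ (hwin y).1 (hwin y).2.1 (hwin y).2.2.1 (hwin y).2.2.2 n x) (hG y).aestronglyMeasurable hC' (hGb y)
    rwa [ENNReal.toReal_add ENNReal.ofReal_ne_top hCp, ENNReal.toReal_ofReal (Real.exp_pos _).le] at h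
  intro n
  refine ⟨hIB hFy hC hFb n, ?_⟩
  show Continuous fun p : Y × PhaseSpace N => ∫ z, F p.1 z ∂(((Kf p.1) ^ n) p.2)
  -- continuity, by induction on `n`
  induction n with
  | zero =>
    have heq : (fun p : Y × PhaseSpace N => ∫ z, F p.1 z ∂(((Kf p.1) ^ 0) p.2)) = fun p => F p.1 p.2 := by
      funext p
      rw [Harris.pow_zero_apply, integral_dirac' _ _ (hFy p.1).stronglyMeasurable]
    rw [heq]; exact hF
  | succ n ih =>
    -- `Kⁿ⁺¹ F = K (Kⁿ F) = R (Q (Kⁿ F))`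
    set G : Y → PhaseSpace N → ℝ := fun y x => ∫ z, F y z ∂(((Kf y) ^ n) x) with hG
    have hGc : Continuous fun p : Y × PhaseSpace N => G p.1 p.2 := ih
    have hGy : ∀ y, Continuous (G y) := fun y =>
      (show Continuous (Function.uncurry G) from hGc).uncurry_left y
    set C₁ : ℝ := C * (1 + Cp.toReal) with hC₁
    have hC₁0 : 0 ≤ C₁ := by positivity
    have hGb : ∀ y x, |G y x| ≤ C₁ * Real.exp (ϑ * Hm x) := by
      intro y x
      refine ((hIB hFy hC hFb n y x).2).trans ?_
      have h1 : 1 ≤ Real.exp (ϑ * Hm x) :=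
        Real.one_le_exp (mul_nonneg hϑ.le (pinnedChain_hamiltonian_nonneg hω.le hl.le hβ.le γ N x))
      rw [hC₁]
      nlinarith [mul_nonneg hC (ENNReal.toReal_nonneg : 0 ≤ Cp.toReal)]
    obtain ⟨hQc, hQb⟩ := flipAverage_continuous_bound hN hGc hGb
    obtain ⟨-, hRc⟩ := continuous_integral_resolventKernel_param hω hl hβ hγ hN hT hϑ h2ϑT hτL hτR hwin
      hQc hC₁0 hQb hr
    have heq : (fun p : Y × PhaseSpace N => ∫ z, F p.1 z ∂(((Kf p.1) ^ (n + 1)) p.2)) =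
        fun p => ∫ z, (N : ℝ)⁻¹ * ∑ i : Fin N, G p.1 (momentumFlip i z) ∂((Rf p.1) p.2) := by
      funext p
      have hFint : Integrable (F p.1) (((Kf p.1) ^ (n + 1)) p.2) := (hIB hFy hC hFb (n + 1) p.1 p.2).1
      rw [Harris.pow_succ_eq_comp, Kernel.comp_apply] at hFint ⊢
      rw [Harris.integral_comp_measure _ _ hFint]
      have hGint : Integrable (G p.1) ((Kf p.1) p.2) := by
        simpa using (hIB hGy hC₁0 hGb 1 p.1 p.2).1
      exact integral_embeddedFlipKernel_eq _ hN r p.2 hGint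
    rw [heq]
    exact hRc

end JointFeller

/-- Registered helper sub-goal `helper_responseDensityNoisyDysonJointFeller` of stmt-AtomisticToContinuum-11975
(= `continuous_integral_embeddedFlipKernel_pow_param`, fully quantified, notation-free one-line form). -/
theorem helper_responseDensityNoisyDysonJointFeller : ∀ (ω₂ lam β γ : ℝ) (hω : 0 < ω₂) (hl : 0 < lam) (hβ : 0 < β) (hγ : 0 < γ) (N : ℕ) (hN : 0 < N) (T : ℝ), 0 < T → ∀ (ϑ : ℝ), 0 < ϑ → 2 * ϑ < 1 / (2 * T) → ∀ (Y : Type) [TopologicalSpace Y] [FirstCountableTopology Y] (τL τR : Y → ℝ), Continuous τL → Continuous τR → ∀ (hwin : ∀ y, 0 < τL y ∧ τL y ≤ 2 * T ∧ 0 < τR y ∧ τR y ≤ 2 * T) (r : ℝ), 0 < r → ∃ Cp : ℝ, 0 ≤ Cp ∧ ∀ (F : Y → Literature.MathematicalPhysics.KineticTheory.HeatConduction.PhaseSpace N → ℝ), (Continuous fun p : Y × Literature.MathematicalPhysics.KineticTheory.HeatConduction.PhaseSpace N => F p.1 p.2) → ∀ (C : ℝ), 0 ≤ C → (∀ y x,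 |F y x| ≤ C * Real.exp (ϑ * (Literature.MathematicalPhysics.KineticTheory.HeatConduction.pinnedChain ω₂ lam β γ).hamiltonian N x)) → ∀ n : ℕ, (∀ (y : Y) (x : Literature.MathematicalPhysics.KineticTheory.HeatConduction.PhaseSpace N), MeasureTheory.Integrable (F y) ((((Literature.MathematicalPhysics.KineticTheory.HeatConduction.pinnedChainSemigroup hω hl.le hβ.le hγ.le hN (hwin y).1.le (hwin y).2.2.1.le).embeddedFlipKernel r) ^ n) x) ∧ |∫ z, F y z ∂((((Literature.MathematicalPhysics.KineticTheory.HeatConduction.pinnedChainSemigroup hω hl.le hβ.le hγ.le hN (hwin y).1.le (hwin y).2.2.1.le).embeddedFlipKernel r) ^ n) x)| ≤ C * (Real.exp (ϑ * (Literature.MathematicalPhysics.KineticTheory.HeatConduction.pinnedChain ω₂ lam β γ).hamiltonian N x) + Cp)) ∧ Continuous fun p : Y × Literature.MathematicalPhysics.KineticTheory.HeatConduction.PhaseSpace N => ∫ z, F p.1 z ∂((((Literature.MathematicalPhysics.KineticTheory.HeatConduction.pinnedChainSemigroup hω hl.le hβ.le hγ.le hN (hwin p.1).1.le (hwin p.1).2.2.1.le).embeddedFlipKernel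 r) ^ n) p.2) :=
  fun _ _ _ _ hω hl hβ hγ _ hN _ hT _ hϑ h2ϑT _ _ _ _ _ hτL hτR hwin _ hr => by
    obtain ⟨Cp, hCp, h⟩ := continuous_integral_embeddedFlipKernel_pow_param hω hl hβ hγ hN hT hϑ h2ϑT hτL hτR hwin hr
    exact ⟨Cp, hCp, fun F hF C hC hFb n => h hF hC hFb n⟩

end Summit.AtomisticToContinuum.FouriersLaw.Theorems.NoiseLocality.StubResponseDensityNoisy.Dyson

end
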